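import Summits.NavierStokesRegularity.NavierStokesRegularity.Theorems.FilamentSkeletonRssCoreGluingRssPackaging
import Summits.NavierStokesRegularity.NavierStokesRegularity.Theorems.RdssProfileTruncation.Negative.FactorGuard
import Literature.Analysis.FluidPDE.SelfSimilar
import Literature.Analysis.FluidPDE.AxisymmetricVorticityTransport
import HarnessLib

/-!
# Route CorkscrewDynamo · crux `CorkscrewProfile` (stmt-NavierStokesRegularity-11282) — algebra of rotated
# discrete self-similarity about the `e₃`-axis (lead c4, line `registered`, tool stub F1)

Registered tool stub `stub_rdssIterate` of the near-identity rigidity theorem: the pure-algebra toolkit for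
fields `u : ℝ → ℝ³ → ℝ³` which are rotated `c`-DSS about `e₃` through `rotZLIE θ`
(`IsRotatedDSS c (rotZLIE θ) u : ∀ t x, c • R_{−θ} u(c²t, c R_θ x) = u(t, x)`, Chae–Wolf 2017, Def. 1.1).

* `IsRotatedDSS.trans_mul` — GROUP LAW for a general isometry: `(a, R)`-RDSS and `(b, S)`-RDSS give
  `(ab, S ∘ R)`-RDSS; specialised to the axis rotations, `IsRotatedDSS.rotZ_mul`:
  `(a, R_α)` and `(b, R_β)` give `(ab, R_{α+β})` (`rotZLIE_trans`).
* `IsRotatedDSS.rotZ_iterate` — ITERATES: `(c, R_θ)`-RDSS gives `(cᵏ, R_{kθ})`-RDSS for every `k : ℕ`.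
* `IsRotatedDSS.rotZ_inv` — INVERSE PAIR: `(c, R_θ)`-RDSS with `0 < c` gives `(c⁻¹, R_{−θ})`-RDSS
  (`rotZLIE_symm` and the tree's `RdssProfileTruncation.Negative.isRotatedDSS_inv'`).
* `rotZLIE_sub_two_pi_mul` / `isRotatedDSS_rotZ_sub_two_pi_mul_iff` — `2π`-PERIODICITY in the angle:
  `rotZLIE (θ − 2πm) = rotZLIE θ`, so the RDSS law only sees `θ mod 2π`.
* the action of `R_θ` on the standard basis (`R_θ e₁ = cos θ e₁ + sin θ e₂`, `R_θ e₂ = −sin θ e₁ + cos θ e₂`,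
  `R_θ e₃ = e₃`), the `Rot` clause of `FilamentSkeletonRss.RssProfileExists`, is the tree's
  `rssPackaging_rotZLIE_pinned` (file `FilamentSkeletonRssCoreGluingRssPackaging`), reused verbatim.

The registered signature `stub_rdssIterate` bundles the four facts (iterates, inverse, periodicity, basis).
-/

noncomputable section

open Set Function Literature.Analysis.FluidPDE

namespace Summit.NavierStokesRegularity.NavierStokesRegularity.Theorems.CorkscrewProfile.Birth

set_option linter.dupNamespace false

/-! ### Group law for a general isometry -/

section Algebra

variable {E : Type*} [NormedAddCommGroup E] [NormedSpace ℝ E]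

/-- **Group law of rotated discrete self-similarity.** If `u` is `(a, R)`-RDSS and `(b, S)`-RDSS then it is
`(ab, S ∘ R)`-RDSS: `u(t,x) = a R⁻¹ u(a²t, aRx) = a R⁻¹ b S⁻¹ u(b²a²t, b S a R x)`. -/
theorem IsRotatedDSS.trans_mul {a b : ℝ} {R S : E ≃ₗᵢ[ℝ] E} {u : ℝ → E → E} (ha : IsRotatedDSS a R u)
    (hb : IsRotatedDSS b S u) : IsRotatedDSS (a * b) (R.trans S) u := by
  intro t x
  have e1 : (a * b) ^ 2 * t = b ^ 2 * (a ^ 2 * t) := by ring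
  have e2 : (a * b) • (R.trans S) x = b • S (a • R x) := by
    rw [LinearIsometryEquiv.trans_apply, map_smul, smul_smul, mul_comm]
  rw [e1, e2, ← ha t x, ← hb (a ^ 2 * t) (a • R x)]
  simp only [LinearIsometryEquiv.symm_trans, LinearIsometryEquiv.trans_apply, map_smul, smul_smul]

end Algebra

/-! ### The axis rotations `rotZLIE θ` as a one-parameter group -/

/-- `R_β ∘ R_α = R_{α+β}` as linear isometry equivalences. -/
theorem rotZLIE_trans (α β : ℝ) : (rotZLIE α).trans (rotZLIE β) = rotZLIE (α + β) := by
  refine LinearIsometryEquiv.ext fun x => ?_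
  simp only [LinearIsometryEquiv.trans_apply, rotZLIE_apply]
  rw [add_comm, rotZ_add]

/-- `R_θ⁻¹ = R_{−θ}` as linear isometry equivalences. -/
theorem rotZLIE_symm (θ : ℝ) : (rotZLIE θ).symm = rotZLIE (-θ) :=
  LinearIsometryEquiv.ext fun x => by simp only [rotZLIE_symm_apply, rotZLIE_apply]

/-- `R_0 = id` as linear isometry equivalences. -/
theorem rotZLIE_zero : rotZLIE 0 = LinearIsometryEquiv.refl ℝ (EuclideanSpace ℝ (Fin 3)) :=
  LinearIsometryEquiv.ext fun x => by simp only [rotZLIE_apply, rotZ_zero, LinearIsometryEquiv.coe_refl, id]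

/-- `2π`-periodicity of the rotations about `e₃`, pointwise: `R_{θ − 2πm} x = R_θ x`. -/
theorem rotZ_sub_two_pi_mul (θ : ℝ) (m : ℤ) (x : EuclideanSpace ℝ (Fin 3)) :
    rotZ (θ - 2 * Real.pi * m) x = rotZ θ x := by
  rw [show θ - 2 * Real.pi * m = θ - m * (2 * Real.pi) by ring]
  ext i
  fin_cases i <;> simp [Real.cos_sub_int_mul_two_pi, Real.sin_sub_int_mul_two_pi]

/-- `2π`-periodicity of the rotations about `e₃`: `rotZLIE (θ − 2πm) = rotZLIE θ`. -/
theorem rotZLIE_sub_two_pi_mul (θ : ℝ) (m : ℤ) : rotZLIE (θ - 2 * Real.pi * m) = rotZLIE θ :=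
  LinearIsometryEquiv.ext fun x => by simp only [rotZLIE_apply, rotZ_sub_two_pi_mul]

/-! ### Rotated DSS about the axis: composition, iterates, inverse, periodicity -/

/-- **Group law about the axis.** `(a, R_α)`-RDSS and `(b, R_β)`-RDSS give `(ab, R_{α+β})`-RDSS. -/
theorem IsRotatedDSS.rotZ_mul {a b α β : ℝ} {u : ℝ → EuclideanSpace ℝ (Fin 3) → EuclideanSpace ℝ (Fin 3)}
    (ha : IsRotatedDSS a (rotZLIE α) u) (hb : IsRotatedDSS b (rotZLIE β) u) :
    IsRotatedDSS (a * b) (rotZLIE (α + β)) u := by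
  rw [← rotZLIE_trans]
  exact IsRotatedDSS.trans_mul ha hb

/-- `(1, R_0)`-RDSS holds for every field. -/
theorem isRotatedDSS_one_rotZLIE_zero (u : ℝ → EuclideanSpace ℝ (Fin 3) → EuclideanSpace ℝ (Fin 3)) :
    IsRotatedDSS 1 (rotZLIE 0) u := by
  rw [rotZLIE_zero]
  exact RdssProfileTruncation.Negative.isRotatedDSS_one_refl' u

/-- **Iterates.** `(c, R_θ)`-RDSS gives `(cᵏ, R_{kθ})`-RDSS for every `k : ℕ`. -/
theorem IsRotatedDSS.rotZ_iterate {c θ : ℝ} {u : ℝ → EuclideanSpace ℝ (Fin 3) → EuclideanSpace ℝ (Fin 3)}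
    (h : IsRotatedDSS c (rotZLIE θ) u) (k : ℕ) : IsRotatedDSS (c ^ k) (rotZLIE (k * θ)) u := by
  induction k with
  | zero =>
    rw [pow_zero, Nat.cast_zero, zero_mul]
    exact isRotatedDSS_one_rotZLIE_zero u
  | succ k ih =>
    rw [pow_succ, Nat.cast_succ, add_mul, one_mul]
    exact IsRotatedDSS.rotZ_mul ih h

/-- **Inverse pair about the axis.** `(c, R_θ)`-RDSS with `0 < c` gives `(c⁻¹, R_{−θ})`-RDSS. -/
theorem IsRotatedDSS.rotZ_inv {c θ : ℝ} {u : ℝ → EuclideanSpace ℝ (Fin 3) → EuclideanSpace ℝ (Fin 3)}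
    (hc : 0 < c) (h : IsRotatedDSS c (rotZLIE θ) u) : IsRotatedDSS c⁻¹ (rotZLIE (-θ)) u := by
  rw [← rotZLIE_symm]
  exact RdssProfileTruncation.Negative.isRotatedDSS_inv' h hc.ne'

/-- **Inverse pair about the axis**, `c ≠ 0` version. -/
theorem IsRotatedDSS.rotZ_inv_of_ne_zero {c θ : ℝ}
    {u : ℝ → EuclideanSpace ℝ (Fin 3) → EuclideanSpace ℝ (Fin 3)}
    (hc : c ≠ 0) (h : IsRotatedDSS c (rotZLIE θ) u) : IsRotatedDSS c⁻¹ (rotZLIE (-θ)) u := by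
  rw [← rotZLIE_symm]
  exact RdssProfileTruncation.Negative.isRotatedDSS_inv' h hc

/-- **`2π`-periodicity in the angle.** The RDSS law about the axis only sees `θ mod 2π`. -/
theorem isRotatedDSS_rotZ_sub_two_pi_mul_iff (c θ : ℝ) (m : ℤ)
    (u : ℝ → EuclideanSpace ℝ (Fin 3) → EuclideanSpace ℝ (Fin 3)) :
    IsRotatedDSS c (rotZLIE θ) u ↔ IsRotatedDSS c (rotZLIE (θ - 2 * Real.pi * m)) u := by
  rw [rotZLIE_sub_two_pi_mul]

/-- Iterates with the angle reduced mod `2π`: `(c, R_θ)`-RDSS gives `(cᵏ, R_{kθ − 2πm})`-RDSS. -/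
theorem IsRotatedDSS.rotZ_iterate_sub_two_pi_mul {c θ : ℝ}
    {u : ℝ → EuclideanSpace ℝ (Fin 3) → EuclideanSpace ℝ (Fin 3)}
    (h : IsRotatedDSS c (rotZLIE θ) u) (k : ℕ) (m : ℤ) :
    IsRotatedDSS (c ^ k) (rotZLIE (k * θ - 2 * Real.pi * m)) u :=
  (isRotatedDSS_rotZ_sub_two_pi_mul_iff (c ^ k) (k * θ) m u).1 (IsRotatedDSS.rotZ_iterate h k)

/-! ### The registered signature -/

/-- **Tool stub F1 (registered signature).** Iterates, inverse pair, `2π`-periodicity in the angle, and the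
action on the standard basis (the tree's `rssPackaging_rotZLIE_pinned`) of a rotated discrete self-similarity
about the `e₃`-axis. -/
theorem stub_rdssIterate :
    (∀ (c θ : ℝ) (u : ℝ → EuclideanSpace ℝ (Fin 3) → EuclideanSpace ℝ (Fin 3)),
      Literature.Analysis.FluidPDE.IsRotatedDSS c (Literature.Analysis.FluidPDE.rotZLIE θ) u →
        ∀ k : ℕ, Literature.Analysis.FluidPDE.IsRotatedDSS (c ^ k) (Literature.Analysis.FluidPDE.rotZLIE (k * θ)) u) ∧
    (∀ (c θ : ℝ) (u : ℝ → EuclideanSpace ℝ (Fin 3) → EuclideanSpace ℝ (Fin 3)), 0 < c →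
      Literature.Analysis.FluidPDE.IsRotatedDSS c (Literature.Analysis.FluidPDE.rotZLIE θ) u →
        Literature.Analysis.FluidPDE.IsRotatedDSS c⁻¹ (Literature.Analysis.FluidPDE.rotZLIE (-θ)) u) ∧
    (∀ (c θ : ℝ) (m : ℤ) (u : ℝ → EuclideanSpace ℝ (Fin 3) → EuclideanSpace ℝ (Fin 3)),
      Literature.Analysis.FluidPDE.IsRotatedDSS c (Literature.Analysis.FluidPDE.rotZLIE θ) u ↔
        Literature.Analysis.FluidPDE.IsRotatedDSS c (Literature.Analysis.FluidPDE.rotZLIE (θ - 2 * Real.pi * m)) u) ∧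
    (∀ θ : ℝ, Literature.Analysis.FluidPDE.rotZLIE θ (EuclideanSpace.single 0 1) =
        Real.cos θ • EuclideanSpace.single 0 1 + Real.sin θ • EuclideanSpace.single 1 1 ∧
      Literature.Analysis.FluidPDE.rotZLIE θ (EuclideanSpace.single 1 1) =
        -(Real.sin θ • EuclideanSpace.single 0 1) + Real.cos θ • EuclideanSpace.single 1 1 ∧
      Literature.Analysis.FluidPDE.rotZLIE θ (EuclideanSpace.single 2 1) = EuclideanSpace.single 2 1) :=
  ⟨fun _ _ _ h k => IsRotatedDSS.rotZ_iterate h k, fun _ _ _ hc h => IsRotatedDSS.rotZ_inv hc h,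
    fun c θ m u => isRotatedDSS_rotZ_sub_two_pi_mul_iff c θ m u, rssPackaging_rotZLIE_pinned⟩

end Summit.NavierStokesRegularity.NavierStokesRegularity.Theorems.CorkscrewProfile.Birth
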